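import Literature.IUT.HodgeTheaters.PiAvatarBaseKit
import Literature.IUT.HodgeTheaters.PlaceKitBridge
import HarnessLib

/-!
# KIT-INSTANCE-SPEC P5-binding (IV-b): the genuine base kit INDEXED BY `V̲` — a `PlaceKit D` whose kit is `baseKitOfData` over the
# `Type 0` copy of `V̲` ([IUTchI] Def 3.1 (e), Def 6.1; one def — post-freeze additive D13, not a cone member)

S. Mochizuki, *Inter-universal Teichmüller theory I*, kurims manuscript (May 2020), Def 3.1 (e) p. 62 (`V̲ ⊆ V(K)`, `V̲^bad`, `V̲^arc`), Def 6.1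
(ii)–(vii) pp. 156–159 (the `𝒟`-data indexed by `v̲ ∈ V̲`) ([IUTchI] Def 3.1 (e) p.62) [claim: Mochizuki2012, status: disputed] (D-0012 claim key,
series status DISPUTED — a construction over abc-iut-L5-t2's REAL `InitialThetaData`; nothing of the series is asserted, no side is taken on
[IUTchIII] Cor. 3.12).

## What is built
**`InitialThetaData.placeKitOfData (δ : D.IndexCopy → D.LocalDatum CG hS) : PlaceKit D`** — abc-iut-L5-t4's place-kit bridge structure
(`PlaceKit`, p415508: a `PMBaseKit` whose index set IS `V̲`, `bad ↔ V̲^bad`, `arc ↔ V̲^arc`) instantiated with the GENUINE kit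
`baseKitOfData` (p444202) on `V := D.IndexCopy` (the `Type 0` copy of the infinite set `V̲`, `indexCopyEquiv : IndexCopy ≃ V̲`),
`bad := indexCopyBad`, `arc := indexCopyArc`; so every L5/L6/c312 declaration over a `PlaceKit`/`PMBaseKit` specialises to the real
initial Θ-data along `placeKitOfData δ`. What remains per place is the datum `δ v : D.LocalDatum CG hS`: at good nonarchimedean `v̲`
`LocalDatum.ofGood (G_v̲) (Λ_v̲) (hA)` (p444931) with `G_v̲ := decompositionSubgroupGF …` (abc-iut-L5-t2 `InitialThetaDataLocalGalois`);
at bad `v̲` the SHAPE-OF-RECORD pair (G-L5t4g3-2 (iii)); **at `v̲ ∈ V̲^arc` the «A3-INTERFACE» CONVENTION (abc-iut-L5-lead RULINGS #57 (3) R3):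
the archimedean `𝒟_v̲` (an Aut-holomorphic orbispace, [IUTchI] Ex 3.4 / Def 6.1 (ii)(iii)(vii), [AbsTopIII] Cor 2.4) is represented by its
profinite π₁-avatar with the order-≤2 decomposition group — the Aut-holomorphic structure, the `K_v`-core and Def 6.1 (ii)(iii) at
archimedean places are NOT captured by this kit; the genuine archimedean adapter is L4's programme («ARCH-A3-ADAPTER»).**
No instance, no notation; typed ≠ proved elsewhere; binder ≠ fact.
-/

noncomputable section

namespace Literature.IUT.HodgeTheaters

open CategoryTheory

universe u v w

section PlaceKitOfData

variable {F : Type u} {K : Type v} {Fbar : Type w} [Field F] [NumberField F] [Field K] [NumberField K]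
  [Algebra F K] [Field Fbar] [Algebra F Fbar] [Algebra K Fbar]
  {E : WeierstrassCurve F} [E.IsElliptic] {l : ℕ} {Pb : BadPlacePredicates K}
  (D : InitialThetaData F K Fbar E l Pb) (CG : D.geom.pe.CuspGalois) (hS : D.CuspClassesNormaliserStable) [Fact l.Prime]
  [(D.PiXund.subgroupOf D.PiXK).Normal] (hsurj : Function.Surjective D.toFlStarGlobal)

namespace InitialThetaData

open Classical in
/-- **The genuine [IUTchI] §6 base kit as a PLACE KIT over `V̲`** (Def 3.1 (e) / Def 6.1): `baseKitOfData` on the `Type 0` copy of `V̲` with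
`bad`, `arc` the indices over `V̲^bad`, `V̲^arc`, and the identification `e := indexCopyEquiv`. The local data `δ` are the per-place
inputs (good: `LocalDatum.ofGood`; bad: the pair of record; arc: A3-INTERFACE convention — see the module docstring).
([IUTchI] Def 3.1 (e) p.62) [claim: Mochizuki2012, status: disputed] -/
def placeKitOfData (δ : D.IndexCopy → D.LocalDatum CG hS) : PlaceKit.{w} D where
  kit := D.baseKitOfData CG hS hsurj D.indexCopyBad D.indexCopyArc δ
  e := D.indexCopyEquiv
  mem_bad_iff := D.mem_indexCopyBad_iff
  mem_arc_iff := D.mem_indexCopyArc_iff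

/-- The index-to-valuation map of the genuine place kit is the identification of the copy with `V̲`.
([IUTchI] Def 3.1 (e) p.62) [claim: Mochizuki2012, status: disputed] -/
theorem placeKitOfData_val (δ : D.IndexCopy → D.LocalDatum CG hS) (x : (D.placeKitOfData CG hS hsurj δ).kit.V) :
    (D.placeKitOfData CG hS hsurj δ).val x = D.indexCopyVal x := rfl

/-- The model object of the genuine place kit at an index is the local object `ℬ(Π_v̲)⁰` of its datum.
([IUTchI] Def 4.1 (i) p.95) [claim: Mochizuki2012, status: disputed] -/
theorem placeKitOfData_model (δ : D.IndexCopy → D.LocalDatum CG hS) (x : D.IndexCopy) :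
    ((D.placeKitOfData CG hS hsurj δ).kit.model x).obj = (δ x).locObj := rfl

/-- The global model of the genuine place kit is `𝒟^{⊚±} = ℬ(Π_{X̲_K})⁰`. ([IUTchI] Def 6.1 (v) p.158) [claim: Mochizuki2012, status: disputed] -/
theorem placeKitOfData_gModel (δ : D.IndexCopy → D.LocalDatum CG hS) :
    ((D.placeKitOfData CG hS hsurj δ).kit.gModel).obj = D.gModelObj := rfl

end InitialThetaData

end PlaceKitOfData

end Literature.IUT.HodgeTheaters
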